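import Summits.Ventures.PercRepro.RankLevelSetDepCountGen
import Summits.Ventures.PercRepro.RankLevelSetLevelFive
import Summits.Ventures.PercRepro.RankLevelSetDepCountMult
import Summits.Ventures.PercRepro.RankLevelSetLevelFiveArithMultA
import Summits.Ventures.PercRepro.RankLevelSetLevelFiveArithMultB
import Summits.Ventures.PercRepro.RankLevelSetLevelFiveArithMultC
import Summits.Ventures.PercRepro.S1TriangleCount
import Summits.Ventures.PercRepro.S1FourCircuitCount
import Summits.Ventures.PercRepro.RankLevelSetPlaneTenPrime
import Summits.Ventures.PercRepro.RankLevelSetCoreFiveNineteen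
import Summits.Ventures.PercRepro.RankLevelSetCorankFiveCounts
import Summits.Ventures.PercRepro.S2FiveWindow

/-!
# PercRepro — THEOREM C₅, THE S2 CHAIN OF RECORD: MULTIPLICITY-WEIGHTED SPLIT COUNT + NULLITY CAP + `f(5) ≤ 19` +
LEMMAS T, T4 — C-025 AT LEVEL `5` FOR EVERY FINITE MATROID AND EVERY `p ≥ 83` (p7, gen 0; sub-claim S2)

`proofs/SUBCLAIM-S2-p7.md` R3′. The level-`5` assembly of night-1's MULTIPLICITY count (RankLevelSetDepCountMult:
`#{B : r B = 5, |B| ≤ d} ≤ C(n, 5) + Σ_{m=6}^{d} #{|B| = m}` and `(m − 5)·#{|B| = m} ≤ C(f′ − 5, m − 6)·small +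
C(f − 6, m − 6)·big` — a dependent rank-`5` set of `m` points holds `≥ m − 5` pairs `(C, B′)`), with the NULLITY CAP
(p8; `|X| ≤ r(X) + d`, `ncard_le_add_of_eRk_le_of_encard_eq` below, over night-1's
`Matroid.encard_le_eRk_add_of_encard_eq`) on both flat bounds, mine-4's `f(5) ≤ 19`
(`ncard_le_nineteen_of_eRk_le_five_of_free`, RankLevelSetPlaneTenPrime), p2's LEMMA T `2·s₃ ≤ d(d+1)`
(S1TriangleCount) and LEMMA T4 `3·s₄ ≤ d(d+1)(d+2)` (S1FourCircuitCount), the polynomial inequalities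
`level_five_poly_mult` (`p ≥ 82`, coranks `6 … 25`, in `ℚ` with the weights `Σ_j C(·, j)/(j + 1)`; the
twenty cases in RankLevelSetLevelFiveArithMultA/B/C, the dispatcher below), and coranks `≥ 26` by `c025_core_five_nineteen` (`p ≥ 27`).

* **`level_five_poly_mult`** — the dispatcher of the twenty polynomial inequalities;
* **`ncard_le_add_of_eRk_le_of_encard_eq`** — the nullity cap in `ncard` form: a set of rank `≤ k` has `≤ k + d` points;
* **`topCount_le_mult`** — the weighted `U`-count in `ℚ`: `#U ≤ C(n,5) + A_d·small + B_d·big`;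
* **`c025_core_five_bounded_corank_mult`** — the `e`-free core at level `5`, corank `6 ≤ d ≤ 25`, rank `p ≥ 82`;
* **`c025_five_of_four_mult`** — level `4` for all `p ≥ 82` implies level `5` for every `p ≥ 83`;
* **`c025_five_large_mult`** — UNCONDITIONAL over the landed tree: every finite matroid satisfies C-025 at level `5`
  for every `p ≥ 83`; `c025_five_large_mult'` is the set-builder spelling of `C025` at `(p, 5)`.
Axioms: standard.
-/

open scoped Matroid

namespace PercRepro

/-- **`(P_d)` at level `5`, multiplicity-weighted split count (cap, `f(5) ≤ 19`, T, T4), every corank `6 ≤ d ≤ 25`,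
every `p ≥ 82`, in `ℚ`.** -/
theorem level_five_poly_mult (d : ℕ) (hd1 : 6 ≤ d) (hd2 : d ≤ 25) (p : ℕ) (hp : 82 ≤ p) :
    8 * (((p + d).choose 5 : ℚ) +
      (∑ j ∈ Finset.range (d - 5), (Nat.choose (min 5 (d - 1)) j : ℚ) / (j + 1)) *
        ((d * (d + 1) / 2 * (p + d).choose 3 + d * (d + 1) * (d + 2) / 3 * (p + d).choose 2 + (d + 4).choose 5 * (p + d) + (d + 5).choose 6 : ℕ) : ℚ) +
      (∑ j ∈ Finset.range (d - 5), (Nat.choose (min 13 (d - 1)) j : ℚ) / (j + 1)) *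
        ((d * (d + 1) / 2 * (6 * d).choose 3 + d * (d + 1) * (d + 2) / 3 * (6 * d).choose 2 + (d + 4).choose 5 * (6 * d) + (d + 5).choose 6 : ℕ) : ℚ)) ≤
      7 * 2 ^ (d - 5) * ((p + 5).choose 5 : ℚ) := by
  interval_cases d
  · exact level_five_poly_mult_6 p hp
  · exact level_five_poly_mult_7 p hp
  · exact level_five_poly_mult_8 p hp
  · exact level_five_poly_mult_9 p hp
  · exact level_five_poly_mult_10 p hp
  · exact level_five_poly_mult_11 p hp
  · exact level_five_poly_mult_12 p hp
  · exact level_five_poly_mult_13 p hp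
  · exact level_five_poly_mult_14 p hp
  · exact level_five_poly_mult_15 p hp
  · exact level_five_poly_mult_16 p hp
  · exact level_five_poly_mult_17 p hp
  · exact level_five_poly_mult_18 p hp
  · exact level_five_poly_mult_19 p hp
  · exact level_five_poly_mult_20 p hp
  · exact level_five_poly_mult_21 p hp
  · exact level_five_poly_mult_22 p hp
  · exact level_five_poly_mult_23 p hp
  · exact level_five_poly_mult_24 p hp
  · exact level_five_poly_mult_25 p hp

namespace ThmN

open Set

variable {α : Type}

/-- **The nullity cap** on a rank-`p` matroid with `|E| = p + d`: a set of rank `≤ k` has at most `k + d` points. -/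
theorem ncard_le_add_of_eRk_le_of_encard_eq (M : Matroid α) [M.Finite] {d : ℕ}
    (hd : M.E.encard = M.eRank + d) {k : ℕ} {X : Set α} (hX : X ⊆ M.E) (hr : M.eRk X ≤ k) :
    X.ncard ≤ k + d := by
  have h1 : X.encard ≤ M.eRk X + d := Matroid.encard_le_eRk_add_of_encard_eq hX hd
  have hXfin : X.Finite := M.ground_finite.subset hX
  have h2 : (X.ncard : ℕ∞) ≤ ((k + d : ℕ) : ℕ∞) := by
    rw [hXfin.cast_ncard_eq]
    calc X.encard ≤ M.eRk X + d := h1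
      _ ≤ (k : ℕ∞) + d := by gcongr
      _ = ((k + d : ℕ) : ℕ∞) := by push_cast; rfl
  exact_mod_cast h2

/-- **The multiplicity-weighted `U`-count in `ℚ`** on a rank-`p` matroid with `|E| = p + d`, `d ≥ 6`, every circuit of
`≥ 3` elements, the capped flat bounds `min 19 (5 + d)` / `min 10 (4 + d)`, and the circuit bounds `s₃ ≤ d(d+1)/2`,
`s₄ ≤ d(d+1)(d+2)/3`, `s₅ ≤ C(d+4, 5)`, `s₆ ≤ C(d+5, 6)`:
`#U(p, 5) ≤ C(p+d, 5) + A_d·small + B_d·big` with `A_d = Σ_{j<d−5} C(min 5 (d−1), j)/(j+1)`,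
`B_d = Σ_{j<d−5} C(min 13 (d−1), j)/(j+1)`. -/
theorem topCount_le_mult (M : Matroid α) [M.Finite] (p d : ℕ) (hd6 : 6 ≤ d) (hR : M.eRank = (p : ℕ∞))
    (hn : M.E.ncard = p + d) (hd : M.E.encard = M.eRank + d)
    (hcirc : ∀ C, M.IsCircuit C → 3 ≤ C.encard)
    (hflat : ∀ X ⊆ M.E, M.eRk X ≤ 5 → X.ncard ≤ min 19 (5 + d))
    (hflat' : ∀ X ⊆ M.E, M.eRk X ≤ ((5 - 1 : ℕ) : ℕ∞) → X.ncard ≤ min 10 (4 + d))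
    (hs3 : {C | M.IsCircuit C ∧ C.ncard = 3}.ncard ≤ d * (d + 1) / 2)
    (hs4 : {C | M.IsCircuit C ∧ C.ncard = 4}.ncard ≤ d * (d + 1) * (d + 2) / 3)
    (hs5 : {C | M.IsCircuit C ∧ C.ncard = 5}.ncard ≤ (d + 4).choose 5)
    (hs6 : {C | M.IsCircuit C ∧ C.ncard = 6}.ncard ≤ (d + 5).choose 6) :
    (Matroid.topCount M p 5 : ℚ) ≤ ((p + d).choose 5 : ℚ) +
      (∑ j ∈ Finset.range (d - 5), (Nat.choose (min 5 (d - 1)) j : ℚ) / (j + 1)) *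
        ((d * (d + 1) / 2 * (p + d).choose 3 + d * (d + 1) * (d + 2) / 3 * (p + d).choose 2 +
          (d + 4).choose 5 * (p + d) + (d + 5).choose 6 : ℕ) : ℚ) +
      (∑ j ∈ Finset.range (d - 5), (Nat.choose (min 13 (d - 1)) j : ℚ) / (j + 1)) *
        ((d * (d + 1) / 2 * (6 * d).choose 3 + d * (d + 1) * (d + 2) / 3 * (6 * d).choose 2 +
          (d + 4).choose 5 * (6 * d) + (d + 5).choose 6 : ℕ) : ℚ) := by
  classical
  -- the small and big circuit sums, bounded by the numerals
  set small : ℕ := d * (d + 1) / 2 * (p + d).choose 3 + d * (d + 1) * (d + 2) / 3 * (p + d).choose 2 +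
    (d + 4).choose 5 * (p + d) + (d + 5).choose 6 with hsmall_def
  set big : ℕ := d * (d + 1) / 2 * (6 * d).choose 3 + d * (d + 1) * (d + 2) / 3 * (6 * d).choose 2 +
    (d + 4).choose 5 * (6 * d) + (d + 5).choose 6 with hbig_def
  have hsm : ∑ k ∈ Finset.Icc 3 (5 + 1), {C | M.IsCircuit C ∧ C.ncard = k}.ncard * M.E.ncard.choose (5 + 1 - k) ≤
      small := by
    rw [sum_Icc_three_six, hn]
    simp only [show (5 : ℕ) + 1 - 3 = 3 from rfl, show (5 : ℕ) + 1 - 4 = 2 from rfl,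
      show (5 : ℕ) + 1 - 5 = 1 from rfl, show (5 : ℕ) + 1 - 6 = 0 from rfl, Nat.choose_one_right,
      Nat.choose_zero_right, mul_one, hsmall_def]
    gcongr
  have hbg : ∑ k ∈ Finset.Icc 3 (5 + 1), {C | M.IsCircuit C ∧ C.ncard = k}.ncard * ((5 + 1) * d).choose (5 + 1 - k) ≤
      big := by
    rw [sum_Icc_three_six]
    simp only [show (5 : ℕ) + 1 - 3 = 3 from rfl, show (5 : ℕ) + 1 - 4 = 2 from rfl,
      show (5 : ℕ) + 1 - 5 = 1 from rfl, show (5 : ℕ) + 1 - 6 = 0 from rfl, Nat.choose_one_right,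
      Nat.choose_zero_right, mul_one, show (5 : ℕ) + 1 = 6 from rfl, hbig_def]
    gcongr
  -- the per-size inequalities of the multiplicity count
  have hm1 : min 19 (5 + d) - (5 + 1) = min 13 (d - 1) := by omega
  have hm2 : min 10 (4 + d) - 5 = min 5 (d - 1) := by omega
  have hper : ∀ m ∈ Finset.Icc 6 d,
      ({B : Set α | B ⊆ M.E ∧ M.eRk B = 5 ∧ B.ncard = m}.ncard : ℚ) ≤
        ((Nat.choose (min 5 (d - 1)) (m - 6) : ℚ) / ((m : ℚ) - 5)) * (small : ℚ) +
        ((Nat.choose (min 13 (d - 1)) (m - 6) : ℚ) / ((m : ℚ) - 5)) * (big : ℚ) := by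
    intro m hm
    rw [Finset.mem_Icc] at hm
    have h := Matroid.ncard_eRk_eq_ncard_eq_mul_le M 5 (min 19 (5 + d)) (min 10 (4 + d)) (by norm_num) hcirc hflat
      hflat' hd m
    rw [hm1, hm2, show (5 : ℕ) + 1 = 6 from rfl] at h
    have h' : (m - 5) * {B : Set α | B ⊆ M.E ∧ M.eRk B = 5 ∧ B.ncard = m}.ncard ≤
        Nat.choose (min 5 (d - 1)) (m - 6) * small + Nat.choose (min 13 (d - 1)) (m - 6) * big := by
      refine h.trans ?_
      gcongr
    have hq : ((m - 5 : ℕ) : ℚ) * ({B : Set α | B ⊆ M.E ∧ M.eRk B = 5 ∧ B.ncard = m}.ncard : ℚ) ≤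
        (Nat.choose (min 5 (d - 1)) (m - 6) : ℚ) * (small : ℚ) +
        (Nat.choose (min 13 (d - 1)) (m - 6) : ℚ) * (big : ℚ) := by exact_mod_cast h'
    have hm5 : ((m - 5 : ℕ) : ℚ) = (m : ℚ) - 5 := by
      rw [Nat.cast_sub (by omega)]; norm_num
    have hpos : (0 : ℚ) < (m : ℚ) - 5 := by
      have : (6 : ℚ) ≤ m := by exact_mod_cast hm.1
      linarith
    rw [hm5] at hq
    rw [div_mul_eq_mul_div, div_mul_eq_mul_div, ← add_div, le_div_iff₀ hpos]
    linarith [hq]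
  -- the count
  have hU1 := Matroid.topCount_le_ncard_compl (M := M) hR hd 5
  have hUsum := Matroid.ncard_eRk_eq_ncard_le_le_sum M 5 d
  have hUq : (Matroid.topCount M p 5 : ℚ) ≤ ((p + d).choose 5 : ℚ) +
      ∑ m ∈ Finset.Icc 6 d, ({B : Set α | B ⊆ M.E ∧ M.eRk B = 5 ∧ B.ncard = m}.ncard : ℚ) := by
    have h := hU1.trans hUsum
    rw [hn, show (5 : ℕ) + 1 = 6 from rfl] at h
    exact_mod_cast h
  have hsum : ∑ m ∈ Finset.Icc 6 d, ({B : Set α | B ⊆ M.E ∧ M.eRk B = 5 ∧ B.ncard = m}.ncard : ℚ) ≤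
      (∑ m ∈ Finset.Icc 6 d, (Nat.choose (min 5 (d - 1)) (m - 6) : ℚ) / ((m : ℚ) - 5)) * (small : ℚ) +
      (∑ m ∈ Finset.Icc 6 d, (Nat.choose (min 13 (d - 1)) (m - 6) : ℚ) / ((m : ℚ) - 5)) * (big : ℚ) := by
    rw [Finset.sum_mul, Finset.sum_mul, ← Finset.sum_add_distrib]
    exact Finset.sum_le_sum hper
  -- reindex the weights `Icc 6 d → range (d − 5)`
  have hreA : ∑ m ∈ Finset.Icc 6 d, (Nat.choose (min 5 (d - 1)) (m - 6) : ℚ) / ((m : ℚ) - 5) =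
      ∑ j ∈ Finset.range (d - 5), (Nat.choose (min 5 (d - 1)) j : ℚ) / (j + 1) := by
    rw [← Finset.Ico_succ_right_eq_Icc, Order.succ_eq_add_one, Finset.sum_Ico_eq_sum_range,
      show d + 1 - 6 = d - 5 by omega]
    refine Finset.sum_congr rfl (fun j _ => ?_)
    rw [show 6 + j - 6 = j by omega]
    push_cast
    ring
  have hreB : ∑ m ∈ Finset.Icc 6 d, (Nat.choose (min 13 (d - 1)) (m - 6) : ℚ) / ((m : ℚ) - 5) =
      ∑ j ∈ Finset.range (d - 5), (Nat.choose (min 13 (d - 1)) j : ℚ) / (j + 1) := by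
    rw [← Finset.Ico_succ_right_eq_Icc, Order.succ_eq_add_one, Finset.sum_Ico_eq_sum_range,
      show d + 1 - 6 = d - 5 by omega]
    refine Finset.sum_congr rfl (fun j _ => ?_)
    rw [show 6 + j - 6 = j by omega]
    push_cast
    ring
  rw [hreA, hreB] at hsum
  linarith [hUq, hsum]

/-- **The `e`-free core at level `5`, corank `6 ≤ d ≤ 25`, rank `p ≥ 82`** (multiplicity-weighted split count
with the nullity cap, `f(5) ≤ 19`, Lemmas T and T4). -/
theorem c025_core_five_bounded_corank_mult (M : Matroid α) [M.Finite] (p d : ℕ) (hp : 82 ≤ p) (hd6 : 6 ≤ d)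
    (hd25 : d ≤ 25) (hR : M.eRank = (p : ℕ∞)) (hn : M.E.ncard = p + d)
    (hfree : ∀ e ∈ M.E, ∃ A ⊆ M.E \ {e}, e ∉ M.closure A ∧ e ∉ M.closure ((M.E \ {e}) \ A)) :
    RLS M p 5 := by
  classical
  have hEcard : M.ground_finite.toFinset.card = p + d := by
    rw [← Set.ncard_eq_toFinset_card _ M.ground_finite]; exact hn
  -- the core is simple: every circuit has `≥ 3` elements
  have hL0 : ∀ e ∈ M.E, ¬ M.IsLoop e := not_isLoop_of_free M hfree
  have hs : ∀ e ∈ M.E, ∀ f ∈ M.E, e ≠ f → M.eRk {e, f} = 2 := by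
    intro e he f hf hef
    have h2 : (2 : ℕ∞) ≤ M.eRk {e, f} :=
      two_le_eRk_of_two_le_ncard_of_free M hfree (pair_subset he hf) (by rw [ncard_pair hef])
    have h3 : M.eRk {e, f} ≤ 2 := by
      have := M.eRk_le_encard {e, f}
      rwa [encard_pair hef] at this
    exact le_antisymm h3 h2
  have hcirc : ∀ C, M.IsCircuit C → 3 ≤ C.encard := three_le_encard_of_circuit M hL0 hs
  have hd : M.E.encard = M.eRank + d := by
    rw [hR, ← M.ground_finite.cast_ncard_eq, hn]
    push_cast
    ring
  -- the capped flat bounds: rank-`≤ 5` sets have `≤ min 19 (5 + d)` points, rank-`≤ 4` sets `≤ min 10 (4 + d)`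
  have hflat : ∀ X ⊆ M.E, M.eRk X ≤ 5 → X.ncard ≤ min 19 (5 + d) := fun X hX hr =>
    le_min (ncard_le_nineteen_of_eRk_le_five_of_free M hfree hX hr)
      (ncard_le_add_of_eRk_le_of_encard_eq M hd hX hr)
  have hflat' : ∀ X ⊆ M.E, M.eRk X ≤ ((5 - 1 : ℕ) : ℕ∞) → X.ncard ≤ min 10 (4 + d) := fun X hX hr =>
    le_min (ncard_le_ten_of_eRk_le_four_of_free M hfree hX (by simpa using hr))
      (ncard_le_add_of_eRk_le_of_encard_eq M hd hX (by simpa using hr))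
  -- the circuit counts: Lemma T, Lemma T4, and the nullity bounds
  have hC1 : ∀ L ⊆ M.E, M.eRk L = 2 → L.ncard ≤ 3 :=
    fun L hL hr => ncard_le_three_of_eRk_two M hs hfree hL hr
  have hC1' : ∀ L ⊆ M.E, M.eRk L ≤ 2 → L.ncard ≤ 3 := fun L hL hr => by
    have := ncard_add_one_le_two_pow_of_eRk_le M hL0 hfree 2 L hL hr
    omega
  have hC2 : ∀ P ⊆ M.E, M.eRk P ≤ 3 → P.ncard ≤ 6 :=
    fun P hP hr => ncard_le_six_of_eRk_le_three_of_free M hfree hP hr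
  have hs3 : {C | M.IsCircuit C ∧ C.ncard = 3}.ncard ≤ d * (d + 1) / 2 := by
    have := S1.two_mul_ncard_triangles_le M hC1 hd
    unfold triangles at this
    omega
  have hs4 : {C | M.IsCircuit C ∧ C.ncard = 4}.ncard ≤ d * (d + 1) * (d + 2) / 3 := by
    have := S1.three_mul_ncard_four_circuits_le M hC1' hC2 hd
    omega
  have hs5 : {C | M.IsCircuit C ∧ C.ncard = 5}.ncard ≤ (d + 4).choose 5 :=
    Matroid.ncard_circuits_le_choose_of_encard M hd 4
  have hs6 : {C | M.IsCircuit C ∧ C.ncard = 6}.ncard ≤ (d + 5).choose 6 :=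
    Matroid.ncard_circuits_le_choose_of_encard M hd 5
  -- (U), weighted, in `ℚ`
  have hUq := topCount_le_mult M p d hd6 hR hn hd hcirc hflat hflat' hs3 hs4 hs5 hs6
  -- (Y)
  have hflat21 : ∀ X ⊆ M.E, M.eRk X ≤ 5 → X.ncard ≤ 21 :=
    fun X hX hr => ncard_le_twentyone_of_eRk_le_five_of_free M hfree hX hr
  have hY := Matroid.two_pow_le_midCount_add (M := M) p 5 hR
  have hA : {X : Set α | X ⊆ M.E ∧ M.eRk X ≤ 5}.ncard ≤ ∑ j ∈ Finset.range (21 + 1), (p + d).choose j := by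
    calc {X : Set α | X ⊆ M.E ∧ M.eRk X ≤ 5}.ncard
        ≤ {X : Set α | X ⊆ (M.ground_finite.toFinset : Set α) ∧ X.ncard ≤ 21}.ncard := by
          apply ncard_le_ncard
          · intro X hX
            exact ⟨by rw [Set.Finite.coe_toFinset]; exact hX.1, hflat21 X hX.1 hX.2⟩
          · exact (Finset.finite_toSet _).finite_subsets.subset (fun X hX => hX.1)
      _ ≤ ∑ j ∈ Finset.range (21 + 1), M.ground_finite.toFinset.card.choose j :=
          ncard_subsets_ncard_le _ 21
      _ = ∑ j ∈ Finset.range (21 + 1), (p + d).choose j := by rw [hEcard]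
  have hB := Matroid.ncard_spanning_le (M := M) hd
  rw [hEcard] at hY hB
  -- the tails
  have hT : 16 * ∑ j ∈ Finset.range 28, (p + d).choose j ≤ 2 ^ (p + d) :=
    sixteen_mul_sum_choose_le_twentyseven (p + d) (by omega)
  have hA' : ∑ j ∈ Finset.range (21 + 1), (p + d).choose j ≤ ∑ j ∈ Finset.range 28, (p + d).choose j :=
    Finset.sum_le_sum_of_subset_of_nonneg (Finset.range_mono (by norm_num)) (fun _ _ _ => Nat.zero_le _)
  have hB' : ∑ j ∈ Finset.range (d + 1), (p + d).choose j ≤ ∑ j ∈ Finset.range 28, (p + d).choose j :=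
    Finset.sum_le_sum_of_subset_of_nonneg (Finset.range_mono (by omega)) (fun _ _ _ => Nat.zero_le _)
  have hAB : 8 * ({X : Set α | X ⊆ M.E ∧ M.eRk X ≤ 5}.ncard +
      {X : Set α | X ⊆ M.E ∧ M.eRk X = M.eRank}.ncard) ≤ 2 ^ (p + d) := by
    have h1 := hA.trans hA'
    have h2 := hB.trans hB'
    omega
  -- (Φ) and the polynomial inequality
  have hΦ := phiK_le_two_pow_div p 5
  rw [Nat.choose_symm_add] at hΦ
  have hpolyq := level_five_poly_mult d hd6 hd25 p hp
  rw [add_assoc] at hUq hpolyq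
  -- assemble in `ℚ`
  rw [RLS_iff]
  have hYq : (2 : ℚ) ^ (p + d) ≤ (Matroid.midCount M p 5 : ℚ) +
      ({X : Set α | X ⊆ M.E ∧ M.eRk X ≤ 5}.ncard : ℚ) +
      ({X : Set α | X ⊆ M.E ∧ M.eRk X = M.eRank}.ncard : ℚ) := by exact_mod_cast hY
  have hABq : 8 * (({X : Set α | X ⊆ M.E ∧ M.eRk X ≤ 5}.ncard : ℚ) +
      ({X : Set α | X ⊆ M.E ∧ M.eRk X = M.eRank}.ncard : ℚ)) ≤ 2 ^ (p + d) := by exact_mod_cast hAB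
  have hU0 : (0 : ℚ) ≤ (Matroid.topCount M p 5 : ℚ) := Nat.cast_nonneg _
  have hd5 : 5 ≤ d := by omega
  exact level_arith (p := p) (d := d) (n := p + d) (q := 5) rfl hd5 hΦ hU0 hUq hYq hABq hpolyq

/-- **THEOREM C₅, THE S2 CHAIN, GIVEN LEVEL `4`**: level `4` for all `p ≥ 82` implies level `5` for all `p ≥ 83`
(the S2 reduction `rls_five_of_four_of_core 82`: coranks `6 … 25` by the weighted cells, `≥ 26` by
`c025_core_five_nineteen`). -/
theorem c025_five_of_four_mult (h4 : ∀ (M : Matroid α) [M.Finite] (p : ℕ), 82 ≤ p → RLS M p 4) :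
    ∀ (M : Matroid α) [M.Finite] (p : ℕ), 83 ≤ p → RLS M p 5 := by
  refine S2.rls_five_of_four_of_core 82 (by norm_num) h4 ?_
  intro M _ p hP hR hbig hfree
  rcases Nat.lt_or_ge M.E.ncard (p + 26) with h | h
  · exact c025_core_five_bounded_corank_mult M p (M.E.ncard - p) hP (by omega) (by omega) hR (by omega) hfree
  · exact c025_core_five_nineteen M p (by omega) hR (by omega) hfree

/-- **THEOREM C₅, THE S2 CHAIN, UNCONDITIONAL**: every finite matroid satisfies C-025 at level `5` for every
`p ≥ 83` (level `4` from THEOREM C₄ `c025_four_large`, `p ≥ 60`). -/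
theorem c025_five_large_mult (M : Matroid α) [M.Finite] (p : ℕ) (hp : 83 ≤ p) : RLS M p 5 :=
  c025_five_of_four_mult (fun M _ p hp => c025_four_large M p (by omega)) M p hp

/-- The level-`5` statement at `p ≥ 83` in the vocabulary of `C025`. -/
theorem c025_five_large_mult' (M : Matroid α) [M.Finite] (p : ℕ) (hp : 83 ≤ p) :
    phiK p 5 * ({A : Set α | A ⊆ M.E ∧ M.eRk A = (p : ℕ∞) ∧ M.eRk (M.E \ A) = (5 : ℕ∞)}.ncard : ℚ) ≤
      ({A : Set α | A ⊆ M.E ∧ (5 : ℕ∞) < M.eRk A ∧ M.eRk A < (p : ℕ∞)}.ncard : ℚ) :=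
  c025_five_large_mult M p hp

end ThmN

end PercRepro
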